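import Summits.Ventures.CertifiedManyBodySolver.Downfold.EmeryFermiScaleFace
import HarnessLib

/-!
# THE t′-HARMONIC LAW OF THE ONE-BAND SCALE: on every contour of the σ three-band model the inverse velocity-matched hopping is AFFINE in
# `s(k) = (1 − cos k_x cos k_y)/2`, `1/t_eff(k; ε) = (α(ε) + 8β(ε)·s(k))/fsT(ε)²`, with `β = fsT²·d|t′/t|/dε` — the ordering of `t_eff` ALONG the
# Fermi surface is decided by the sign of the energy slope of the contour's own `|t′/t|`

Venture CertifiedManyBodySolver, cell `pub/hubbard-downfold` (stage S1; INFLATION-RULES-3to1-B §B.74 — the SCALE leg of the 3 → 1 reduction), seat hubbard-downfold-mod-4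
(technique B, g30); namespace `Summit.Ventures.CertifiedManyBodySolver.Downfold.Emery`. Sequel of `EmeryFermiSurfaceShapeBox` §2 (`dcharCubic`, `scaleT = fsT/∂_ε charCubic`),
`EmeryFermiVelocityScale` (the affine-in-`x + y` description, which divides by `fsN`) and `EmeryFermiScaleNode/Axis/Face` (closed forms at three special Fermi points).
Everything PROVED (0 sorry; `ring` identities + sign bookkeeping). WHAT THIS IS NOT: a statement about any material; `U = 0` one-body kinematics of the σ model as printed.

* §1 THE IDENTITY (no contour hypothesis, no division): `fsT·∂_ε charCubic − fsT′·charCubic = α + 8β·(x + y − 2xy)` (`fsT_mul_dcharCubic_sub`) with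
  `α = cA′·fsT − cA·fsT′ = (Δ + ε)[t_pd²Δ(Δ + 4g) + 3t_pd²(Δ + 4g)ε + (2t_pd² + 4(t_pp² − t_pp′²) − t_pp′Δ)ε² − t_pp′ε³]` (`scaleAlpha_eq`), `g = t_pp + t_pp′`,
  `β = fsN′·fsT − fsN·fsT′ = g·[t_pp′(t_pp − t_pp′)ε² + 4t_pd²t_pp′ε + t_pd²(gΔ − 2t_pd²)]` (`scaleBeta_eq`; at `t_pp′ = 0`: `β = t_pp t_pd²(t_ppΔ − 2t_pd²)`, `scaleBeta_pure`) and
  the t′ HARMONIC `tpHarm x y = x + y − 2xy = (1 − cos k_x cos k_y)/2 ∈ [0, 1]` (`tpHarm_eq_cos`, `tpHarm_mem_Icc`; face `1 − y`, diagonal `2x(1 − x)`, axis `x`).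
  `β/fsT²` is the energy derivative of `fsN/fsT = |t′/t|(ε)` of the contour (`EmeryFermiSurfaceShape.fsRatio = −fsN/fsT`), `α/fsT²` that of `cA/fsT`.
* §2 ON A CONTOUR (`charCubic = 0`): `fsT·∂_ε charCubic = α + 8β·s` and **`t_eff(k; ε) = scaleT = fsT²/(α + 8β·s(k))`** (`scaleT_eq_harmonic`) — ONE formula for every Fermi point;
  the closed forms of the node (`s = 2xNode(1 − xNode)`), the axis point (`s = xAxis`) and the antinode (`s = 1 − yFace`; `scaleFaceD_mul_fsT`: `4(t_pd²faceN + faceR)·fsT = α·F + 8β·H`,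
  `F = 4fsD + 16fsN`, `H = 8fsD + 16fsN − cA`) are its three instances.
* §3 ORDERING ALONG ONE CONTOUR: `t_eff` is a MONOTONE function of `s(k)` — non-increasing if `β ≥ 0`, non-decreasing if `β ≤ 0`, constant if `β = 0`
  (`scaleT_anti_tpHarm`, `scaleT_mono_tpHarm`, `scaleT_const_of_beta_zero`; pure d–p model `t_pp = t_pp′ = 0` ⇒ `β = 0` ⇒ uniform scale on every contour, `scaleT_pure_dp_uniform`).
  READING: `β < 0` ⇔ the contour's `|t′/t|` DECREASES with energy ⇔ hole doping RAISES `|t′/t|`; exactly then the velocity-matched `t` GROWS from small-`s` Fermi points toward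
  large-`s` ones (the antinode of a hole-like surface has `s = 1 − yFace` near 1). At `t_pp′ = 0` the divide is `t_ppΔ = 2t_pd²` at EVERY energy.

Sources: three-band model [HybertsenSchluterChristensen1989, Eq. (1)]; energy-linearised downfolding, `t, t′` language [AndersenEtAl1995, §6]; [folklore] algebra.
-/

noncomputable section

namespace Summit.Ventures.CertifiedManyBodySolver.Downfold.Emery

open Real Set

/-! ## §1 The identity -/

/-- Energy derivative of the contour hopping `fsT = fsD + 2fsN`: `fsT′ = fsD′ + 2fsN′ = t_pd² − t_pp′(Δ + 2ε) + 2(t_pp² − t_pp′²)`. [folklore] -/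
def dfsT (Δ tpd tpp c ε : ℝ) : ℝ := dfsD Δ tpd c ε + 2 * dfsN tpp c

/-- `α = cA′·fsT − cA·fsT′` (`fsT²` times the energy derivative of `cA/fsT`). [folklore] -/
def scaleAlpha (Δ tpd tpp c ε : ℝ) : ℝ := dcA Δ ε * fsT Δ tpd tpp c ε - cA Δ ε * dfsT Δ tpd tpp c ε

/-- `β = fsN′·fsT − fsN·fsT′` (`fsT²` times the energy derivative of the contour shape ratio `fsN/fsT = |t′/t|`). [folklore] -/
def scaleBeta (Δ tpd tpp c ε : ℝ) : ℝ := dfsN tpp c * fsT Δ tpd tpp c ε - fsN tpd tpp c ε * dfsT Δ tpd tpp c ε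

/-- The `t′` harmonic in the half-angle variables: `tpHarm x y = x + y − 2xy` (`= (1 − cos k_x cos k_y)/2` at `x = sin²(k_x/2)`, `y = sin²(k_y/2)`). [folklore] -/
def tpHarm (x y : ℝ) : ℝ := x + y - 2 * x * y

/-- EXACT TAYLOR IDENTITY for `fsT`: `fsT(ε + h) = fsT(ε) + h·fsT′(ε) − t_pp′h²` — `dfsT` IS the energy derivative (no analysis needed). [folklore] -/
theorem fsT_taylor (Δ tpd tpp c ε h : ℝ) : fsT Δ tpd tpp c (ε + h) = fsT Δ tpd tpp c ε + h * dfsT Δ tpd tpp c ε - c * h ^ 2 := by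
  unfold fsT dfsT fsD fsN dfsD dfsN
  ring

/-- **THE IDENTITY** (every `x, y, ε`; no division): `fsT·∂_ε charCubic − fsT′·charCubic = α + 8β·(x + y − 2xy)`. [folklore] -/
theorem fsT_mul_dcharCubic_sub (Δ tpd tpp c x y ε : ℝ) :
    fsT Δ tpd tpp c ε * dcharCubic Δ tpd tpp c x y ε - dfsT Δ tpd tpp c ε * charCubic Δ tpd tpp c x y ε =
      scaleAlpha Δ tpd tpp c ε + 8 * scaleBeta Δ tpd tpp c ε * tpHarm x y := by
  unfold scaleAlpha scaleBeta tpHarm dfsT dcharCubic charCubic fsT fsD fsN cA dcA dfsD dfsN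
  ring

/-- Closed form of `α`: `α = (Δ + ε)[t_pd²Δ(Δ + 4g) + 3t_pd²(Δ + 4g)ε + (2t_pd² + 4(t_pp² − t_pp′²) − t_pp′Δ)ε² − t_pp′ε³]`, `g = t_pp + t_pp′`. [folklore] -/
theorem scaleAlpha_eq (Δ tpd tpp c ε : ℝ) :
    scaleAlpha Δ tpd tpp c ε = (Δ + ε) * (tpd ^ 2 * Δ * (Δ + 4 * (tpp + c)) + 3 * tpd ^ 2 * (Δ + 4 * (tpp + c)) * ε
      + (2 * tpd ^ 2 + 4 * (tpp ^ 2 - c ^ 2) - c * Δ) * ε ^ 2 - c * ε ^ 3) := by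
  unfold scaleAlpha dfsT fsT fsD fsN cA dcA dfsD dfsN
  ring

/-- Closed form of `β`: `β = (t_pp + t_pp′)·[t_pp′(t_pp − t_pp′)ε² + 4t_pd²t_pp′ε + t_pd²((t_pp + t_pp′)Δ − 2t_pd²)]`. [folklore] -/
theorem scaleBeta_eq (Δ tpd tpp c ε : ℝ) :
    scaleBeta Δ tpd tpp c ε = (tpp + c) * (c * (tpp - c) * ε ^ 2 + 4 * tpd ^ 2 * c * ε + tpd ^ 2 * ((tpp + c) * Δ - 2 * tpd ^ 2)) := by
  unfold scaleBeta dfsT fsT fsD fsN dfsD dfsN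
  ring

/-- At `t_pp′ = 0`: `β = t_pp·t_pd²·(t_ppΔ − 2t_pd²)` — energy INDEPENDENT, negative iff `t_ppΔ < 2t_pd²`. [folklore] -/
theorem scaleBeta_pure (Δ tpd tpp ε : ℝ) : scaleBeta Δ tpd tpp 0 ε = tpp * tpd ^ 2 * (tpp * Δ - 2 * tpd ^ 2) := by
  rw [scaleBeta_eq]; ring

/-- `α > 0` in the regime `Δ ≥ 0`, `0 ≤ t_pp′ ≤ t_pp`, `ε > 0`, `t_pp′(Δ + ε) < 2t_pd²` (a simple sufficient form; on the typed rows `t_pp′(Δ + ε_F) ≈ 0.6 eV² ≪ 2t_pd²`). [folklore] -/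
theorem scaleAlpha_pos {Δ tpd tpp c ε : ℝ} (hΔ : 0 ≤ Δ) (hc : 0 ≤ c) (hct : c ≤ tpp) (hε : 0 < ε) (hm : c * (Δ + ε) < 2 * tpd ^ 2) :
    0 < scaleAlpha Δ tpd tpp c ε := by
  rw [scaleAlpha_eq]
  have hE : 0 < Δ + ε := by linarith
  have h1 : 0 ≤ tpp ^ 2 - c ^ 2 := by nlinarith
  have e3 : tpd ^ 2 * Δ * (Δ + 4 * (tpp + c)) + 3 * tpd ^ 2 * (Δ + 4 * (tpp + c)) * ε
      + (2 * tpd ^ 2 + 4 * (tpp ^ 2 - c ^ 2) - c * Δ) * ε ^ 2 - c * ε ^ 3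
      = tpd ^ 2 * Δ * (Δ + 4 * (tpp + c)) + 3 * tpd ^ 2 * (Δ + 4 * (tpp + c)) * ε
      + (2 * tpd ^ 2 - c * (Δ + ε)) * ε ^ 2 + 4 * (tpp ^ 2 - c ^ 2) * ε ^ 2 := by ring
  rw [e3]
  have hA : 0 ≤ tpd ^ 2 * Δ * (Δ + 4 * (tpp + c)) := mul_nonneg (mul_nonneg (sq_nonneg tpd) hΔ) (by linarith)
  have hB : 0 ≤ 3 * tpd ^ 2 * (Δ + 4 * (tpp + c)) * ε := mul_nonneg (mul_nonneg (mul_nonneg (by norm_num) (sq_nonneg tpd)) (by linarith)) hε.le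
  have hC : 0 < (2 * tpd ^ 2 - c * (Δ + ε)) * ε ^ 2 := mul_pos (sub_pos.2 hm) (pow_pos hε 2)
  have hD : 0 ≤ 4 * (tpp ^ 2 - c ^ 2) * ε ^ 2 := mul_nonneg (mul_nonneg (by norm_num) h1) (sq_nonneg ε)
  exact mul_pos hE (by linarith)

/-- `x = sin²(k/2) = (1 − cos k)/2`: the harmonic is `(1 − cos k_x cos k_y)/2`. [folklore] -/
theorem tpHarm_eq_cos (kx ky : ℝ) : tpHarm ((1 - cos kx) / 2) ((1 - cos ky) / 2) = (1 - cos kx * cos ky) / 2 := by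
  unfold tpHarm; ring

/-- Same with the half-angle sines: `tpHarm (sin²(k_x/2)) (sin²(k_y/2)) = (1 − cos k_x cos k_y)/2`. [folklore] -/
theorem tpHarm_sin_half (kx ky : ℝ) : tpHarm (sin (kx / 2) ^ 2) (sin (ky / 2) ^ 2) = (1 - cos kx * cos ky) / 2 := by
  have hx : sin (kx / 2) ^ 2 = (1 - cos kx) / 2 := by
    have := Literature.Probability.LatticeModels.cos_eq_one_sub_two_mul_sin_half_sq kx; linarith
  have hy : sin (ky / 2) ^ 2 = (1 - cos ky) / 2 := by
    have := Literature.Probability.LatticeModels.cos_eq_one_sub_two_mul_sin_half_sq ky; linarith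
  rw [hx, hy, tpHarm_eq_cos]

/-- On the zone `0 ≤ x, y ≤ 1`: `0 ≤ tpHarm x y ≤ 1` (`s = x(1 − y) + y(1 − x)`, `1 − s = xy + (1 − x)(1 − y)`). [folklore] -/
theorem tpHarm_mem_Icc {x y : ℝ} (hx : x ∈ Set.Icc (0 : ℝ) 1) (hy : y ∈ Set.Icc (0 : ℝ) 1) : tpHarm x y ∈ Set.Icc (0 : ℝ) 1 := by
  obtain ⟨hx0, hx1⟩ := hx; obtain ⟨hy0, hy1⟩ := hy
  unfold tpHarm
  constructor
  · nlinarith [mul_nonneg hx0 (sub_nonneg.2 hy1), mul_nonneg hy0 (sub_nonneg.2 hx1)]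
  · nlinarith [mul_nonneg hx0 hy0, mul_nonneg (sub_nonneg.2 hx1) (sub_nonneg.2 hy1)]

/-- Face value: `tpHarm 1 y = 1 − y`. [folklore] -/
@[simp] theorem tpHarm_face (y : ℝ) : tpHarm 1 y = 1 - y := by unfold tpHarm; ring

/-- Diagonal value: `tpHarm x x = 2x(1 − x)`. [folklore] -/
@[simp] theorem tpHarm_diag (x : ℝ) : tpHarm x x = 2 * x * (1 - x) := by unfold tpHarm; ring

/-- Axis value: `tpHarm x 0 = x`. [folklore] -/
@[simp] theorem tpHarm_axis (x : ℝ) : tpHarm x 0 = x := by unfold tpHarm; ring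

/-- Symmetry: `tpHarm x y = tpHarm y x`. [folklore] -/
theorem tpHarm_comm (x y : ℝ) : tpHarm x y = tpHarm y x := by unfold tpHarm; ring

/-! ## §2 On a contour: one formula for every Fermi point -/

/-- ON A CONTOUR: `fsT·∂_ε charCubic(k; ε) = α(ε) + 8β(ε)·s(k)`. [folklore] -/
theorem fsT_mul_dcharCubic_of_contour {Δ tpd tpp c x y ε : ℝ} (hP : charCubic Δ tpd tpp c x y ε = 0) :
    fsT Δ tpd tpp c ε * dcharCubic Δ tpd tpp c x y ε = scaleAlpha Δ tpd tpp c ε + 8 * scaleBeta Δ tpd tpp c ε * tpHarm x y := by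
  have h := fsT_mul_dcharCubic_sub Δ tpd tpp c x y ε
  rw [hP, mul_zero, sub_zero] at h
  exact h

/-- **THE t′-HARMONIC LAW**: at every contour point, `t_eff(k; ε) = scaleT(x, y; ε) = fsT(ε)²/(α(ε) + 8β(ε)·s(k))` (`fsT ≠ 0`; if the denominator vanishes both sides are `0`). [folklore] -/
theorem scaleT_eq_harmonic {Δ tpd tpp c x y ε : ℝ} (hP : charCubic Δ tpd tpp c x y ε = 0) (hT : fsT Δ tpd tpp c ε ≠ 0) :
    scaleT Δ tpd tpp c x y ε = fsT Δ tpd tpp c ε ^ 2 / (scaleAlpha Δ tpd tpp c ε + 8 * scaleBeta Δ tpd tpp c ε * tpHarm x y) := by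
  have h := fsT_mul_dcharCubic_of_contour hP
  have hd : dcharCubic Δ tpd tpp c x y ε = (scaleAlpha Δ tpd tpp c ε + 8 * scaleBeta Δ tpd tpp c ε * tpHarm x y) / fsT Δ tpd tpp c ε := by
    rw [eq_div_iff hT]; linarith [h]
  unfold scaleT
  rw [hd, div_div_eq_mul_div, sq]

/-- The inverse scale is AFFINE in the harmonic: `1/t_eff(k; ε) = (α + 8β·s(k))/fsT²` on the contour. [folklore] -/
theorem inv_scaleT_eq_harmonic {Δ tpd tpp c x y ε : ℝ} (hP : charCubic Δ tpd tpp c x y ε = 0) (hT : fsT Δ tpd tpp c ε ≠ 0) :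
    (scaleT Δ tpd tpp c x y ε)⁻¹ = (scaleAlpha Δ tpd tpp c ε + 8 * scaleBeta Δ tpd tpp c ε * tpHarm x y) / fsT Δ tpd tpp c ε ^ 2 := by
  rw [scaleT_eq_harmonic hP hT, inv_div]

/-- THE ANTINODE INSTANCE as a pure identity: `4(t_pd²·faceN + faceR)·fsT = α·(4fsD + 16fsN) + 8β·(8fsD + 16fsN − cA)`, i.e. `scaleFaceD·fsT = α·F + 8β·H` — the closed form
`scaleT_face_eq` is `fsT²/(α + 8β(1 − yFace))` with `1 − yFace = H/F`. [folklore] -/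
theorem scaleFaceD_mul_fsT (Δ tpd tpp c ε : ℝ) :
    scaleFaceD Δ tpd tpp c ε * fsT Δ tpd tpp c ε =
      scaleAlpha Δ tpd tpp c ε * (4 * fsD Δ tpd c ε + 16 * fsN tpd tpp c ε) + 8 * scaleBeta Δ tpd tpp c ε * (8 * fsD Δ tpd c ε + 16 * fsN tpd tpp c ε - cA Δ ε) := by
  unfold scaleFaceD faceN faceR scaleAlpha scaleBeta dfsT fsT fsD fsN cA dcA dfsD dfsN
  ring

/-- The antinodal scale through the harmonic law: `scaleT(1, yFace; ε) = fsT²/(α + 8β·(1 − yFace))` (`4fsD + 16fsN ≠ 0`, `fsT ≠ 0`). [folklore] -/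
theorem scaleT_face_harmonic {Δ tpd tpp c ε : ℝ} (hF : 4 * fsD Δ tpd c ε + 16 * fsN tpd tpp c ε ≠ 0) (hT : fsT Δ tpd tpp c ε ≠ 0) :
    scaleT Δ tpd tpp c 1 (yFace Δ tpd tpp c ε) ε = fsT Δ tpd tpp c ε ^ 2 / (scaleAlpha Δ tpd tpp c ε + 8 * scaleBeta Δ tpd tpp c ε * (1 - yFace Δ tpd tpp c ε)) := by
  rw [scaleT_eq_harmonic (charCubic_yFace hF) hT, tpHarm_face]

/-- The nodal scale through the harmonic law: `scaleT(xNode, xNode; ε) = fsT²/(α + 16β·xNode(1 − xNode))` (`fsN1 ≠ 0`, `fsT ≠ 0`). [folklore] -/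
theorem scaleT_node_harmonic {Δ tpd tpp c ε : ℝ} (hN1 : fsN1 tpd tpp c ε ≠ 0) (hT : fsT Δ tpd tpp c ε ≠ 0) :
    scaleT Δ tpd tpp c (xNode Δ tpd tpp c ε) (xNode Δ tpd tpp c ε) ε =
      fsT Δ tpd tpp c ε ^ 2 / (scaleAlpha Δ tpd tpp c ε + 16 * scaleBeta Δ tpd tpp c ε * (xNode Δ tpd tpp c ε * (1 - xNode Δ tpd tpp c ε))) := by
  rw [scaleT_eq_harmonic (charCubic_xNode (Δ := Δ) hN1) hT, tpHarm_diag]; ring_nf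

/-! ## §3 Ordering along one contour: `t_eff` is monotone in the harmonic `s(k)` -/

/-- **`β ≥ 0` ⇒ `t_eff` NON-INCREASING in `s` along the contour**: two points of one contour with `s₁ ≤ s₂` and positive energy denominators have `t_eff(k₂) ≤ t_eff(k₁)`. [folklore] -/
theorem scaleT_anti_tpHarm {Δ tpd tpp c x₁ y₁ x₂ y₂ ε : ℝ} (hP₁ : charCubic Δ tpd tpp c x₁ y₁ ε = 0) (hP₂ : charCubic Δ tpd tpp c x₂ y₂ ε = 0)
    (hT : 0 < fsT Δ tpd tpp c ε) (hW₁ : 0 < dcharCubic Δ tpd tpp c x₁ y₁ ε) (hβ : 0 ≤ scaleBeta Δ tpd tpp c ε) (hs : tpHarm x₁ y₁ ≤ tpHarm x₂ y₂) :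
    scaleT Δ tpd tpp c x₂ y₂ ε ≤ scaleT Δ tpd tpp c x₁ y₁ ε := by
  have h1 := fsT_mul_dcharCubic_of_contour hP₁
  have hd1 : 0 < scaleAlpha Δ tpd tpp c ε + 8 * scaleBeta Δ tpd tpp c ε * tpHarm x₁ y₁ := by rw [← h1]; exact mul_pos hT hW₁
  have hd2 : scaleAlpha Δ tpd tpp c ε + 8 * scaleBeta Δ tpd tpp c ε * tpHarm x₁ y₁ ≤ scaleAlpha Δ tpd tpp c ε + 8 * scaleBeta Δ tpd tpp c ε * tpHarm x₂ y₂ := by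
    nlinarith [mul_le_mul_of_nonneg_left hs hβ]
  rw [scaleT_eq_harmonic hP₁ hT.ne', scaleT_eq_harmonic hP₂ hT.ne']
  exact div_le_div_of_nonneg_left (by positivity) hd1 hd2

/-- **`β ≤ 0` ⇒ `t_eff` NON-DECREASING in `s` along the contour**: `s₁ ≤ s₂`, positive energy denominator at `k₂` ⇒ `t_eff(k₁) ≤ t_eff(k₂)` — when hole doping raises the contour's
`|t′/t|` (`β < 0`), the large-`s` (antinodal-side) Fermi points carry the LARGER velocity-matched `t`. [folklore] -/
theorem scaleT_mono_tpHarm {Δ tpd tpp c x₁ y₁ x₂ y₂ ε : ℝ} (hP₁ : charCubic Δ tpd tpp c x₁ y₁ ε = 0) (hP₂ : charCubic Δ tpd tpp c x₂ y₂ ε = 0)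
    (hT : 0 < fsT Δ tpd tpp c ε) (hW₂ : 0 < dcharCubic Δ tpd tpp c x₂ y₂ ε) (hβ : scaleBeta Δ tpd tpp c ε ≤ 0) (hs : tpHarm x₁ y₁ ≤ tpHarm x₂ y₂) :
    scaleT Δ tpd tpp c x₁ y₁ ε ≤ scaleT Δ tpd tpp c x₂ y₂ ε := by
  have h2 := fsT_mul_dcharCubic_of_contour hP₂
  have hd2 : 0 < scaleAlpha Δ tpd tpp c ε + 8 * scaleBeta Δ tpd tpp c ε * tpHarm x₂ y₂ := by rw [← h2]; exact mul_pos hT hW₂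
  have hd1 : scaleAlpha Δ tpd tpp c ε + 8 * scaleBeta Δ tpd tpp c ε * tpHarm x₂ y₂ ≤ scaleAlpha Δ tpd tpp c ε + 8 * scaleBeta Δ tpd tpp c ε * tpHarm x₁ y₁ := by
    nlinarith [mul_le_mul_of_nonpos_left hs hβ]
  rw [scaleT_eq_harmonic hP₁ hT.ne', scaleT_eq_harmonic hP₂ hT.ne']
  exact div_le_div_of_nonneg_left (by positivity) hd2 hd1

/-- `β = 0` ⇒ the velocity-matched `t` is the SAME at every point of the contour (`= fsT²/α`). [folklore] -/
theorem scaleT_const_of_beta_zero {Δ tpd tpp c x y ε : ℝ} (hP : charCubic Δ tpd tpp c x y ε = 0) (hT : fsT Δ tpd tpp c ε ≠ 0) (hβ : scaleBeta Δ tpd tpp c ε = 0) :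
    scaleT Δ tpd tpp c x y ε = fsT Δ tpd tpp c ε ^ 2 / scaleAlpha Δ tpd tpp c ε := by
  rw [scaleT_eq_harmonic hP hT, hβ]; ring_nf

/-- PURE d–p MODEL (`t_pp = t_pp′ = 0`, perfectly nested contours): `β = 0`, so the scale is uniform on every contour, `t_eff = fsT²/α = t_pd²(Δ + ε)/((Δ + ε)(Δ + 3ε) − ε(Δ + ε))`-type
closed form `fsT²/α`. [folklore] -/
theorem scaleT_pure_dp_uniform {Δ tpd x y ε : ℝ} (hP : charCubic Δ tpd 0 0 x y ε = 0) (hT : fsT Δ tpd 0 0 ε ≠ 0) :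
    scaleT Δ tpd 0 0 x y ε = fsT Δ tpd 0 0 ε ^ 2 / scaleAlpha Δ tpd 0 0 ε :=
  scaleT_const_of_beta_zero hP hT (by rw [scaleBeta_pure]; ring)

/-- THE SIGN OF `β` AT `t_pp′ = 0` (`t_pp > 0`, `t_pd ≠ 0`): `β < 0 ↔ t_ppΔ < 2t_pd²` — the along-the-surface ordering of `t_eff` flips at `t_ppΔ = 2t_pd²`, at every energy. [folklore] -/
theorem scaleBeta_pure_neg_iff {Δ tpd tpp ε : ℝ} (htpp : 0 < tpp) (htpd : tpd ≠ 0) : scaleBeta Δ tpd tpp 0 ε < 0 ↔ tpp * Δ < 2 * tpd ^ 2 := by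
  rw [scaleBeta_pure]
  have ht : 0 < tpd ^ 2 := by positivity
  have hk : 0 < tpp * tpd ^ 2 := mul_pos htpp ht
  constructor
  · intro h
    have hneg : tpp * Δ - 2 * tpd ^ 2 < 0 := by
      by_contra hle
      have := mul_nonneg hk.le (not_lt.mp hle)
      linarith
    linarith
  · intro h
    exact mul_neg_of_pos_of_neg hk (by linarith)

/-- A sufficient sign test for general `t_pp′`: `t_pp′(t_pp − t_pp′)ε² + 4t_pd²t_pp′ε + t_pd²((t_pp + t_pp′)Δ − 2t_pd²) ≤ 0` and `t_pp + t_pp′ ≥ 0` ⇒ `β(ε) ≤ 0`; the bracket is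
non-decreasing in `ε ≥ 0` (for `0 ≤ t_pp′ ≤ t_pp`), so testing it at the TOP of an energy range covers the range (`scaleBeta_core_mono`). [folklore] -/
theorem scaleBeta_nonpos_of {Δ tpd tpp c ε : ℝ} (hg : 0 ≤ tpp + c)
    (h : c * (tpp - c) * ε ^ 2 + 4 * tpd ^ 2 * c * ε + tpd ^ 2 * ((tpp + c) * Δ - 2 * tpd ^ 2) ≤ 0) : scaleBeta Δ tpd tpp c ε ≤ 0 := by
  rw [scaleBeta_eq]; exact mul_nonpos_of_nonneg_of_nonpos hg h

/-- The core bracket of `β` is non-decreasing in `ε ≥ 0` (`0 ≤ t_pp′ ≤ t_pp`). [folklore] -/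
theorem scaleBeta_core_mono {Δ tpd tpp c ε₁ ε₂ : ℝ} (hc : 0 ≤ c) (hct : c ≤ tpp) (h1 : 0 ≤ ε₁) (h12 : ε₁ ≤ ε₂) :
    c * (tpp - c) * ε₁ ^ 2 + 4 * tpd ^ 2 * c * ε₁ + tpd ^ 2 * ((tpp + c) * Δ - 2 * tpd ^ 2) ≤
      c * (tpp - c) * ε₂ ^ 2 + 4 * tpd ^ 2 * c * ε₂ + tpd ^ 2 * ((tpp + c) * Δ - 2 * tpd ^ 2) := by
  have hk : 0 ≤ c * (tpp - c) := mul_nonneg hc (by linarith)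
  nlinarith [mul_le_mul_of_nonneg_left (mul_le_mul h12 h12 h1 (h1.trans h12)) hk, mul_nonneg (sq_nonneg tpd) hc]

end Summit.Ventures.CertifiedManyBodySolver.Downfold.Emery
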